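import Summits.ResolutionOfSingularities.ResolutionOfSingularities.Theorems.PurelyInseparableDim4ChartClosureIdeal
import Summits.ResolutionOfSingularities.ResolutionOfSingularities.Theorems.EquisingularLiftEquisingularLiftNatNDAffineDictionary
import Literature.AlgebraicGeometry.Hironaka2017.Lib.AffineCoordBlowupLSB
import Literature.AlgebraicGeometry.Resolution.Hironaka2005AmbientReductionSchemeOfAffine
import Literature.AlgebraicGeometry.Resolution.Hironaka2005SharpEquiv
import Literature.AlgebraicGeometry.Resolution.BlowupRestrictOpen
import Literature.AlgebraicGeometry.Resolution.RegularSubschemeLocallyIrreducible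
import Literature.AlgebraicGeometry.Morphisms.SubschemeIntegral
import HarnessLib

/-!
# Purely inseparable four-folds `z^p + F(x₁, …, x₄)`: the GRAPH `Y` behind an escaping chart centre is a
# regular integral closed subscheme of `𝔸⁵`, met by the centre in a coordinate subspace
# (brick S3-glob at depth 2, part B1 — scheme level on `𝔸⁵`; cell `res-dim4-pi`, typ-2 g4)

[OURS · counted 0] (D-0157 DOOR 2; DR-157-C; desk WORD #97 (c); frame `PIDim4.TerminationImpliesOrderReduction`,
S3 (c)). Sequel of `…ChartClosureIdeal` (ring level: the graph ideal
`J_Y = (z − H, x_k − b_k (k ∈ S' ∖ S), xᵢ − bᵢ x_j (i ∈ S' ∩ S)) ⊂ K[z, x]`, `j ∉ S'`). Here, on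
`𝔸⁵_K = Spec K[z, x]` with `𝒥_Y = idealSheafOf J_Y`:

* §1 `exists_algEquiv_shear` — the SHEAR automorphism `Ξ₂` (`x_k ↦ x_k − b_k` on `S' ∖ S`,
  `xᵢ ↦ xᵢ − bᵢ x_j` on `S' ∩ S`, identity elsewhere; invertible because `j ∉ S'`); with the cleaning-type
  automorphism `Ξ₁` (`z ↦ z − H`, the dictionary's `exists_algEquiv_clean`):
  `map_map_IΛ_eq_graph` — **`Ξ₁(Ξ₂(z, x_{S'})) = J_Y`**, and `map_map_IΛ_union_eq` —
  `Ξ₁(Ξ₂(z, x_{S ∪ S'})) = (z, x_S) + (x_k − b_k : k ∈ S' ∖ S)` (for `H ∈ (x_S)`).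
* §2 `mem_support_idealSheafOf_iff`, `isPrime_graph`, **`isRegular_subscheme_graph`** (`V(𝒥_Y) ≅ V(z, x_{S'})`
  is regular — an affine space), **`isIntegral_subscheme_graph`**, **`isRegular_subscheme_graph_sup`**
  (`V(𝒥_Y + 𝓘Λ_S)` regular: the centre meets the graph in a coordinate subspace), `comap_subschemeι_graph_ne_bot`
  (`Y ⊄ V(z, x_S)`: the generic point of `Y` has `x_j ≠ 0`).

These are the inputs of Liu 8.1.19 (a) / Stacks 080E for the strict transform of `Y` (sequel
`…ChartClosureStrict`: `Bl_{Y ∩ C} Y` regular and integral, `=` the closure of the escaping chart centre).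
Nothing here is a statement about resolution of singularities in dimension ≥ 4 / characteristic `p` (NOT
proved anywhere in this programme). bears_on: LADDER-RESOLUTION:D157-DOOR2 (res-dim4-pi). Supports
stmt-ResolutionOfSingularities-16155 (helper, S3-glob B1).
-/

-- every declaration of this summit lives under `Summit.ResolutionOfSingularities.ResolutionOfSingularities`
-- (summit = problem), which the duplicate-namespace linter flags; house convention (cf. the Target file).
set_option linter.dupNamespace false

noncomputable section

open MvPolynomial Finset CategoryTheory AlgebraicGeometry Opposite TopologicalSpace

open scoped BigOperators

namespace Summit.ResolutionOfSingularities.ResolutionOfSingularities.Theorems.PIDim4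

open Literature.AlgebraicGeometry.Resolution
open Literature.AlgebraicGeometry.Resolution.AffinePointBlowup (P A γ coord Wtop ξ)
open Literature.RingTheory.MvPolynomial (isPrime_span_X_image X_mem_span_X_image_iff)

namespace ChartDictionary

variable {K : Type} [Field K] {S S' : Finset (Fin 4)} {j : Fin 4} {b : Fin 4 → K}

/-! ## §1 The shear and the cleaning automorphisms carry `(z, x_{S'})` to the graph ideal -/

/-- **The shear automorphism** `Ξ₂` of `K[z, x]`: `x_k ↦ x_k − b_k` (`k ∈ S' ∖ S`), `xᵢ ↦ xᵢ − bᵢ x_j`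
(`i ∈ S' ∩ S`), all other variables fixed — invertible since `j ∉ S'` (its inverse has the signs flipped). -/
theorem exists_algEquiv_shear (hjS' : j ∉ S') (b : Fin 4 → K) :
    ∃ Ξ : A 4 K ≃ₐ[K] A 4 K, Ξ (X 0) = X 0 ∧ ∀ k : Fin 4, Ξ (X k.succ) =
      if k ∈ S' then (if k ∈ S then X k.succ - C (b k) * X j.succ else X k.succ - C (b k)) else X k.succ := by
  classical
  let g : Fin (4 + 1) → A 4 K := Fin.cases (X 0) fun k =>
    if k ∈ S' then (if k ∈ S then X k.succ - C (b k) * X j.succ else X k.succ - C (b k)) else X k.succ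
  let g' : Fin (4 + 1) → A 4 K := Fin.cases (X 0) fun k =>
    if k ∈ S' then (if k ∈ S then X k.succ + C (b k) * X j.succ else X k.succ + C (b k)) else X k.succ
  have hgj : aeval g (X j.succ : A 4 K) = X j.succ := by
    rw [aeval_X]; change (if j ∈ S' then _ else _) = _; rw [if_neg hjS']
  have hg'j : aeval g' (X j.succ : A 4 K) = X j.succ := by
    rw [aeval_X]; change (if j ∈ S' then _ else _) = _; rw [if_neg hjS']
  refine ⟨AlgEquiv.ofAlgHom (aeval g) (aeval g') ?_ ?_, ?_, fun k => ?_⟩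
  · refine MvPolynomial.algHom_ext fun i => ?_
    refine Fin.cases ?_ (fun k => ?_) i
    · simp only [AlgHom.comp_apply, AlgHom.id_apply, aeval_X, g', g, Fin.cases_zero]
    · rw [AlgHom.comp_apply, AlgHom.id_apply, aeval_X]
      change aeval g ((if k ∈ S' then (if k ∈ S then X k.succ + C (b k) * X j.succ else X k.succ + C (b k))
        else X k.succ : A 4 K)) = X k.succ
      by_cases hk' : k ∈ S'
      · by_cases hk : k ∈ S
        · rw [if_pos hk', if_pos hk, map_add, map_mul, aeval_C, hgj, aeval_X, algebraMap_eq]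
          change (if k ∈ S' then _ else _) + _ = _
          rw [if_pos hk', if_pos hk]; ring
        · rw [if_pos hk', if_neg hk, map_add, aeval_C, aeval_X, algebraMap_eq]
          change (if k ∈ S' then _ else _) + _ = _
          rw [if_pos hk', if_neg hk]; ring
      · rw [if_neg hk', aeval_X]
        change (if k ∈ S' then _ else _) = _
        rw [if_neg hk']
  · refine MvPolynomial.algHom_ext fun i => ?_
    refine Fin.cases ?_ (fun k => ?_) i
    · simp only [AlgHom.comp_apply, AlgHom.id_apply, aeval_X, g', g, Fin.cases_zero]
    · rw [AlgHom.comp_apply, AlgHom.id_apply, aeval_X]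
      change aeval g' ((if k ∈ S' then (if k ∈ S then X k.succ - C (b k) * X j.succ else X k.succ - C (b k))
        else X k.succ : A 4 K)) = X k.succ
      by_cases hk' : k ∈ S'
      · by_cases hk : k ∈ S
        · rw [if_pos hk', if_pos hk, map_sub, map_mul, aeval_C, hg'j, aeval_X, algebraMap_eq]
          change (if k ∈ S' then _ else _) - _ = _
          rw [if_pos hk', if_pos hk]; ring
        · rw [if_pos hk', if_neg hk, map_sub, aeval_C, aeval_X, algebraMap_eq]
          change (if k ∈ S' then _ else _) - _ = _
          rw [if_pos hk', if_neg hk]; ring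
      · rw [if_neg hk', aeval_X]
        change (if k ∈ S' then _ else _) = _
        rw [if_neg hk']
  · change aeval g (X 0) = X 0
    rw [aeval_X]; rfl
  · change aeval g (X k.succ) = _
    rw [aeval_X]; rfl

/-- **Shear then clean carries `(z, x_{S'})` onto the graph ideal `J_Y`**: with `Ξ₂` the shear and `Ξ₁` a
cleaning-type automorphism (`Ξ₁ z = z − H`, `Ξ₁ x = x`), `Ξ₁ (Ξ₂ (z, x_{S'})) = J_Y`. -/
theorem map_map_IΛ_eq_graph {Ξ₂ Ξ₁ : A 4 K ≃ₐ[K] A 4 K} (h20 : Ξ₂ (X 0) = X 0)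
    (h2s : ∀ k : Fin 4, Ξ₂ (X k.succ) =
      if k ∈ S' then (if k ∈ S then X k.succ - C (b k) * X j.succ else X k.succ - C (b k)) else X k.succ)
    {H : MvPolynomial (Fin 4) K} (h10 : Ξ₁ (X 0) = X 0 - rename Fin.succ H) (h1s : ∀ i : Fin 4, Ξ₁ (X i.succ) = X i.succ) :
    ((AffineCoordBlowup.IΛ 4 K (insert 0 (Fin.succ '' (S' : Set (Fin 4))))).map (Ξ₂ : A 4 K →+* A 4 K)).map
        (Ξ₁ : A 4 K →+* A 4 K) =
      Ideal.span (insert (X 0 - rename Fin.succ H)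
        (((fun k : Fin 4 => (X k.succ - C (b k) : A 4 K)) '' ((S' \ S : Finset (Fin 4)) : Set (Fin 4))) ∪
         ((fun i : Fin 4 => (X i.succ - C (b i) * X j.succ : A 4 K)) '' ((S' ∩ S : Finset (Fin 4)) : Set (Fin 4))))) := by
  have h1C : ∀ c : K, Ξ₁ (C c) = C c := fun c => Ξ₁.commutes c
  -- images of the generators `z`, `x_k` (`k ∈ S'`) under `Ξ₁ ∘ Ξ₂`
  have hz : Ξ₁ (Ξ₂ (X 0)) = X 0 - rename Fin.succ H := by rw [h20, h10]
  have hk : ∀ k ∈ S', Ξ₁ (Ξ₂ (X k.succ)) =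
      if k ∈ S then X k.succ - C (b k) * X j.succ else X k.succ - C (b k) := by
    intro k hk
    rw [h2s k, if_pos hk]
    split_ifs
    · rw [map_sub, map_mul, h1s, h1s, h1C]
    · rw [map_sub, h1s, h1C]
  rw [Ideal.map_map]
  apply le_antisymm
  · rw [AffineCoordBlowup.IΛ, Ideal.map_span, Ideal.span_le]
    rintro _ ⟨_, ⟨l, hl, rfl⟩, rfl⟩
    rcases hl with rfl | ⟨k, hkS', rfl⟩
    · rw [SetLike.mem_coe, RingHom.comp_apply, RingHom.coe_coe, RingHom.coe_coe, hz]
      exact Ideal.subset_span (Set.mem_insert _ _)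
    · have hkS' : k ∈ S' := Finset.mem_coe.mp hkS'
      rw [SetLike.mem_coe, RingHom.comp_apply, RingHom.coe_coe, RingHom.coe_coe, hk k hkS']
      by_cases hkS : k ∈ S
      · rw [if_pos hkS]
        exact Ideal.subset_span (Set.mem_insert_of_mem _ (Or.inr ⟨k, Finset.mem_coe.mpr (Finset.mem_inter.mpr ⟨hkS', hkS⟩), rfl⟩))
      · rw [if_neg hkS]
        exact Ideal.subset_span (Set.mem_insert_of_mem _ (Or.inl ⟨k, Finset.mem_coe.mpr (Finset.mem_sdiff.mpr ⟨hkS', hkS⟩), rfl⟩))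
  · rw [Ideal.span_le]
    have hmem : ∀ l ∈ (insert 0 (Fin.succ '' (S' : Set (Fin 4))) : Set (Fin (4 + 1))),
        ((Ξ₁ : A 4 K →+* A 4 K).comp (Ξ₂ : A 4 K →+* A 4 K)) (X l) ∈
          (AffineCoordBlowup.IΛ 4 K (insert 0 (Fin.succ '' (S' : Set (Fin 4))))).map
            ((Ξ₁ : A 4 K →+* A 4 K).comp (Ξ₂ : A 4 K →+* A 4 K)) :=
      fun l hl => Ideal.mem_map_of_mem _ (Ideal.subset_span ⟨l, hl, rfl⟩)
    rintro g (rfl | ⟨k, hk', rfl⟩ | ⟨i, hi', rfl⟩)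
    · have h1 := hmem 0 (Set.mem_insert _ _)
      rwa [RingHom.comp_apply, RingHom.coe_coe, RingHom.coe_coe, hz] at h1
    · obtain ⟨hkS', hkS⟩ := Finset.mem_sdiff.mp (Finset.mem_coe.mp hk')
      have h1 := hmem k.succ (Set.mem_insert_of_mem _ ⟨k, hkS', rfl⟩)
      rwa [RingHom.comp_apply, RingHom.coe_coe, RingHom.coe_coe, hk k hkS', if_neg hkS] at h1
    · obtain ⟨hiS', hiS⟩ := Finset.mem_inter.mp (Finset.mem_coe.mp hi')
      have h1 := hmem i.succ (Set.mem_insert_of_mem _ ⟨i, hiS', rfl⟩)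
      rwa [RingHom.comp_apply, RingHom.coe_coe, RingHom.coe_coe, hk i hiS', if_pos hiS] at h1

/-- **A translation carries `(z, x_{S ∪ S'})` onto the ideal of `Y ∩ V(z, x_S)`**: with `τ` the translation
`x_k ↦ x_k − b_k` (`k ∈ S' ∖ S`), identity on `z`, `x_S` and the rest,
`τ (z, x_{S ∪ S'}) = (z, x_S) + (x_k − b_k : k ∈ S' ∖ S)`. -/
theorem map_IΛ_union_translate (b : Fin 4 → K) :
    (AffineCoordBlowup.IΛ 4 K (insert 0 (Fin.succ '' ((S ∪ S' : Finset (Fin 4)) : Set (Fin 4))))).map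
        (AffinePointBlowup.translateEquiv (n := 4)
          (Fin.cases (0 : K) fun k => if k ∈ S' \ S then -b k else 0) : A 4 K →+* A 4 K) =
      AffineCoordBlowup.IΛ 4 K (insert 0 (Fin.succ '' (S : Set (Fin 4)))) ⊔
        Ideal.span ((fun k : Fin 4 => (X k.succ - C (b k) : A 4 K)) '' ((S' \ S : Finset (Fin 4)) : Set (Fin 4))) := by
  classical
  set τ := AffinePointBlowup.translateEquiv (n := 4) (Fin.cases (0 : K) fun k => if k ∈ S' \ S then -b k else 0)
    with hτ
  have hτ0 : τ (X 0) = X 0 := by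
    rw [hτ, AffinePointBlowup.translateEquiv_X, Fin.cases_zero, C_0, add_zero]
  have hτS : ∀ i ∈ S, τ (X i.succ) = X i.succ := fun i hi => by
    rw [hτ, AffinePointBlowup.translateEquiv_X, Fin.cases_succ,
      if_neg (fun h => (Finset.mem_sdiff.mp h).2 hi), C_0, add_zero]
  have hτk : ∀ k ∈ S' \ S, τ (X k.succ) = X k.succ - C (b k) := fun k hk => by
    rw [hτ, AffinePointBlowup.translateEquiv_X, Fin.cases_succ, if_pos hk, C_neg, ← sub_eq_add_neg]
  apply le_antisymm
  · rw [AffineCoordBlowup.IΛ, Ideal.map_span, Ideal.span_le]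
    rintro _ ⟨_, ⟨l, hl, rfl⟩, rfl⟩
    rcases hl with rfl | ⟨k, hk, rfl⟩
    · rw [SetLike.mem_coe, RingHom.coe_coe, hτ0]
      exact Ideal.mem_sup_left (Ideal.subset_span ⟨0, Set.mem_insert _ _, rfl⟩)
    · rcases Finset.mem_union.mp (Finset.mem_coe.mp hk) with hkS | hkS'
      · rw [SetLike.mem_coe, RingHom.coe_coe, hτS k hkS]
        exact Ideal.mem_sup_left (Ideal.subset_span ⟨k.succ, Set.mem_insert_of_mem _ ⟨k, hkS, rfl⟩, rfl⟩)
      · by_cases hkS : k ∈ S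
        · rw [SetLike.mem_coe, RingHom.coe_coe, hτS k hkS]
          exact Ideal.mem_sup_left (Ideal.subset_span ⟨k.succ, Set.mem_insert_of_mem _ ⟨k, hkS, rfl⟩, rfl⟩)
        · rw [SetLike.mem_coe, RingHom.coe_coe, hτk k (Finset.mem_sdiff.mpr ⟨hkS', hkS⟩)]
          exact Ideal.mem_sup_right (Ideal.subset_span ⟨k, Finset.mem_coe.mpr (Finset.mem_sdiff.mpr ⟨hkS', hkS⟩), rfl⟩)
  · have hmem : ∀ l ∈ (insert 0 (Fin.succ '' ((S ∪ S' : Finset (Fin 4)) : Set (Fin 4))) : Set (Fin (4 + 1))),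
        (τ : A 4 K →+* A 4 K) (X l) ∈ (AffineCoordBlowup.IΛ 4 K
          (insert 0 (Fin.succ '' ((S ∪ S' : Finset (Fin 4)) : Set (Fin 4))))).map (τ : A 4 K →+* A 4 K) :=
      fun l hl => Ideal.mem_map_of_mem _ (Ideal.subset_span ⟨l, hl, rfl⟩)
    rw [sup_le_iff, AffineCoordBlowup.IΛ, Ideal.span_le, Ideal.span_le]
    constructor
    · rintro _ ⟨l, hl, rfl⟩
      rcases hl with rfl | ⟨i, hi, rfl⟩
      · have h1 := hmem 0 (Set.mem_insert _ _)
        rwa [RingHom.coe_coe, hτ0] at h1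
      · have h1 := hmem i.succ (Set.mem_insert_of_mem _ ⟨i, Finset.mem_coe.mpr (Finset.mem_union_left _ (Finset.mem_coe.mp hi)), rfl⟩)
        rwa [RingHom.coe_coe, hτS i (Finset.mem_coe.mp hi)] at h1
    · rintro _ ⟨k, hk, rfl⟩
      have hk' := Finset.mem_coe.mp hk
      have h1 := hmem k.succ (Set.mem_insert_of_mem _ ⟨k, Finset.mem_coe.mpr
        (Finset.mem_union_right _ (Finset.mem_sdiff.mp hk').1), rfl⟩)
      rwa [RingHom.coe_coe, hτk k hk'] at h1

/-! ## §2 The graph `Y = V(𝒥_Y)`: regular, integral, meeting the centre in a coordinate subspace -/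

/-- Points of `V(idealSheafOf J)` on `𝔸⁵ = Spec K[z, x]`: the primes containing `J`. -/
theorem mem_support_idealSheafOf_iff (J : Ideal (A 4 K)) (x : P 4 K) :
    x ∈ (Hironaka2005.idealSheafOf J).support ↔ J ≤ x.asIdeal := by
  rw [← SetLike.mem_coe, Hironaka2005.idealSheafOf, Scheme.IdealSheafData.coe_support_ofIdealTop, Spec_zeroLocus]
  change (⇑(Scheme.ΓSpecIso (.of (A 4 K))).inv.hom ⁻¹'
    ((J.map (Scheme.ΓSpecIso (.of (A 4 K))).inv.hom : Ideal _) : Set _)) ⊆ (x.asIdeal : Set (A 4 K)) ↔ _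
  have hsurj : Function.Surjective (Scheme.ΓSpecIso (.of (A 4 K))).inv.hom :=
    (ConcreteCategory.bijective_of_isIso (Scheme.ΓSpecIso (.of (A 4 K))).inv).2
  have hinj : Function.Injective (Scheme.ΓSpecIso (.of (A 4 K))).inv.hom :=
    (ConcreteCategory.bijective_of_isIso (Scheme.ΓSpecIso (.of (A 4 K))).inv).1
  constructor
  · intro h f hf
    exact h (show (Scheme.ΓSpecIso (.of (A 4 K))).inv.hom f ∈ _ from Ideal.mem_map_of_mem _ hf)
  · intro h f hf
    rw [Set.mem_preimage, SetLike.mem_coe, Ideal.mem_map_iff_of_surjective _ hsurj] at hf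
    obtain ⟨g, hg, hgf⟩ := hf
    have : g = f := hinj hgf
    exact h (this ▸ hg)

/-- `Spec` of a `K`-algebra automorphism of `K[z, x]` is an open immersion (an isomorphism). -/
theorem isOpenImmersion_specMap_of_algEquiv (Ξ : A 4 K ≃ₐ[K] A 4 K) :
    IsOpenImmersion (Spec.map (CommRingCat.ofHom (Ξ : A 4 K →+* A 4 K))) := by
  have : IsIso (CommRingCat.ofHom (Ξ : A 4 K →+* A 4 K)) :=
    (inferInstance : IsIso Ξ.toRingEquiv.toCommRingCatIso.hom)
  infer_instance

/-- **`V(idealSheafOf (Ξ(z, x_Λ)))` is regular** for any `K`-algebra automorphism `Ξ` of `K[z, x]`: it is the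
pull-back of the coordinate subspace `V(z, x_Λ)` (an affine space, `AffineCoordBlowupLSB.isRegular_CΛ`) along the
automorphism `Spec Ξ` of `𝔸⁵`. -/
theorem isRegular_subscheme_idealSheafOf_map_IΛ (Λ : Set (Fin (4 + 1))) (Ξ : A 4 K ≃ₐ[K] A 4 K) :
    Scheme.IsRegular (Hironaka2005.idealSheafOf ((AffineCoordBlowup.IΛ 4 K Λ).map (Ξ : A 4 K →+* A 4 K))).subscheme := by
  haveI := isOpenImmersion_specMap_of_algEquiv Ξ
  rw [← Hironaka2005.comap_specMap_idealSheafOf,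
    ← Cruxes.EquisingularLiftNat.Sections.ND.𝓘Λ_eq_idealSheafOf]
  exact Scheme.IsRegular.subscheme_comap_of_isOpenImmersion _
    (Literature.AlgebraicGeometry.Hironaka2017.Lib.AffineCoordBlowupLSB.isRegular_CΛ 4 K Λ)

/-- The same for a composite of two automorphisms. -/
theorem isRegular_subscheme_idealSheafOf_map_map_IΛ (Λ : Set (Fin (4 + 1))) (Ξ₂ Ξ₁ : A 4 K ≃ₐ[K] A 4 K) :
    Scheme.IsRegular (Hironaka2005.idealSheafOf (((AffineCoordBlowup.IΛ 4 K Λ).map (Ξ₂ : A 4 K →+* A 4 K)).map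
      (Ξ₁ : A 4 K →+* A 4 K))).subscheme := by
  have h := isRegular_subscheme_idealSheafOf_map_IΛ Λ (Ξ₂.trans Ξ₁)
  have hc : ((Ξ₂.trans Ξ₁ : A 4 K ≃ₐ[K] A 4 K) : A 4 K →+* A 4 K) =
      (Ξ₁ : A 4 K →+* A 4 K).comp (Ξ₂ : A 4 K →+* A 4 K) := RingHom.ext fun x => rfl
  rwa [hc, ← Ideal.map_map] at h

/-- **The graph `Y` is regular**: `V(𝒥_Y)`, `𝒥_Y = idealSheafOf J_Y`, is a regular scheme (`J_Y = Ξ₁Ξ₂(z, x_{S'})`). -/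
theorem isRegular_subscheme_graph (hjS' : j ∉ S') (b : Fin 4 → K) (H : MvPolynomial (Fin 4) K) :
    Scheme.IsRegular (Hironaka2005.idealSheafOf (Ideal.span (insert (X 0 - rename Fin.succ H)
        (((fun k : Fin 4 => (X k.succ - C (b k) : A 4 K)) '' ((S' \ S : Finset (Fin 4)) : Set (Fin 4))) ∪
         ((fun i : Fin 4 => (X i.succ - C (b i) * X j.succ : A 4 K)) '' ((S' ∩ S : Finset (Fin 4)) : Set (Fin 4))))))).subscheme := by
  obtain ⟨Ξ₂, h20, h2s⟩ := exists_algEquiv_shear (S := S) hjS' b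
  obtain ⟨Ξ₁, h10, h1s⟩ := exists_algEquiv_clean (K := K) (-H)
  rw [map_neg, ← sub_eq_add_neg] at h10
  rw [← map_map_IΛ_eq_graph h20 h2s h10 h1s]
  exact isRegular_subscheme_idealSheafOf_map_map_IΛ _ Ξ₂ Ξ₁

/-- **The graph ideal is prime** (`J_Y = Ξ₁Ξ₂(z, x_{S'})` with `(z, x_{S'})` prime). -/
theorem isPrime_graph (hjS' : j ∉ S') (b : Fin 4 → K) (H : MvPolynomial (Fin 4) K) :
    (Ideal.span (insert (X 0 - rename Fin.succ H)
        (((fun k : Fin 4 => (X k.succ - C (b k) : A 4 K)) '' ((S' \ S : Finset (Fin 4)) : Set (Fin 4))) ∪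
         ((fun i : Fin 4 => (X i.succ - C (b i) * X j.succ : A 4 K)) '' ((S' ∩ S : Finset (Fin 4)) : Set (Fin 4)))))).IsPrime := by
  obtain ⟨Ξ₂, h20, h2s⟩ := exists_algEquiv_shear (S := S) hjS' b
  obtain ⟨Ξ₁, h10, h1s⟩ := exists_algEquiv_clean (K := K) (-H)
  rw [map_neg, ← sub_eq_add_neg] at h10
  rw [← map_map_IΛ_eq_graph h20 h2s h10 h1s]
  haveI := AffineCoordBlowup.isPrime_IΛ 4 K (insert 0 (Fin.succ '' (S' : Set (Fin 4))))
  haveI : ((AffineCoordBlowup.IΛ 4 K (insert 0 (Fin.succ '' (S' : Set (Fin 4))))).map (Ξ₂ : A 4 K →+* A 4 K)).IsPrime :=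
    Ideal.map_isPrime_of_equiv Ξ₂
  exact Ideal.map_isPrime_of_equiv Ξ₁

/-- **The graph `Y` is integral** (regular, hence reduced, with irreducible support `V(J_Y)`, `J_Y` prime). -/
theorem isIntegral_subscheme_graph (hjS' : j ∉ S') (b : Fin 4 → K) (H : MvPolynomial (Fin 4) K) :
    IsIntegral (Hironaka2005.idealSheafOf (Ideal.span (insert (X 0 - rename Fin.succ H)
        (((fun k : Fin 4 => (X k.succ - C (b k) : A 4 K)) '' ((S' \ S : Finset (Fin 4)) : Set (Fin 4))) ∪
         ((fun i : Fin 4 => (X i.succ - C (b i) * X j.succ : A 4 K)) '' ((S' ∩ S : Finset (Fin 4)) : Set (Fin 4))))))).subscheme := by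
  set J := Ideal.span (insert (X 0 - rename Fin.succ H)
        (((fun k : Fin 4 => (X k.succ - C (b k) : A 4 K)) '' ((S' \ S : Finset (Fin 4)) : Set (Fin 4))) ∪
         ((fun i : Fin 4 => (X i.succ - C (b i) * X j.succ : A 4 K)) '' ((S' ∩ S : Finset (Fin 4)) : Set (Fin 4))))) with hJ
  have hreg := isRegular_subscheme_graph (S := S) hjS' b H
  rw [← hJ] at hreg
  refine Literature.AlgebraicGeometry.Morphisms.isIntegral_subscheme _ ?_ ?_
  · have h := eq_vanishingIdeal_support_of_isRegular _ hreg
    rw [Scheme.IdealSheafData.vanishingIdeal_support] at h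
    exact h.symm
  · have hset : ((Hironaka2005.idealSheafOf J).support : Set (P 4 K)) = PrimeSpectrum.zeroLocus (J : Set (A 4 K)) :=
      Set.ext fun x => (mem_support_idealSheafOf_iff J x).trans Iff.rfl
    rw [hset]
    have hprime := isPrime_graph (S := S) hjS' b H
    rw [← hJ] at hprime
    exact (PrimeSpectrum.isIrreducible_zeroLocus_iff J).mpr (by rw [hprime.radical]; exact hprime)

/-- **The centre meets the graph in a regular subscheme**: `V(𝒥_Y + 𝓘Λ_S)` is regular (it is
`V((z, x_S) + (x_k − b_k : k ∈ S' ∖ S))`, a translate of the coordinate subspace `V(z, x_{S ∪ S'})`), for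
`H ∈ (x_S)` (`mem_span_X_of_lift`) and `j ∈ S`. -/
theorem isRegular_subscheme_graph_sup (hj : j ∈ S) (b : Fin 4 → K) {H : MvPolynomial (Fin 4) K}
    (hHS : H ∈ Ideal.span (X '' (S : Set (Fin 4)) : Set (MvPolynomial (Fin 4) K))) :
    Scheme.IsRegular (Hironaka2005.idealSheafOf (Ideal.span (insert (X 0 - rename Fin.succ H)
        (((fun k : Fin 4 => (X k.succ - C (b k) : A 4 K)) '' ((S' \ S : Finset (Fin 4)) : Set (Fin 4))) ∪
         ((fun i : Fin 4 => (X i.succ - C (b i) * X j.succ : A 4 K)) '' ((S' ∩ S : Finset (Fin 4)) : Set (Fin 4)))))) ⊔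
      AffineCoordBlowup.𝓘Λ 4 K (insert 0 (Fin.succ '' (S : Set (Fin 4))))).subscheme := by
  rw [Cruxes.EquisingularLiftNat.Sections.ND.𝓘Λ_eq_idealSheafOf, ← Hironaka2005.idealSheafOf_sup, graph_sup_IΛ hj hHS,
    ← map_IΛ_union_translate (S := S) (S' := S') b]
  exact isRegular_subscheme_idealSheafOf_map_IΛ _ _

/-- **`Y ⊄ V(z, x_S)`**: the centre ideal restricted to the graph is not the zero ideal sheaf (the generic
point `J_Y` of `Y` does not contain `x_j`, `j ∈ S`, `j ∉ S'`). -/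
theorem comap_subschemeι_graph_ne_bot (hj : j ∈ S) (hjS' : j ∉ S') (b : Fin 4 → K) (H : MvPolynomial (Fin 4) K) :
    (AffineCoordBlowup.𝓘Λ 4 K (insert 0 (Fin.succ '' (S : Set (Fin 4))))).comap
      (Hironaka2005.idealSheafOf (Ideal.span (insert (X 0 - rename Fin.succ H)
        (((fun k : Fin 4 => (X k.succ - C (b k) : A 4 K)) '' ((S' \ S : Finset (Fin 4)) : Set (Fin 4))) ∪
         ((fun i : Fin 4 => (X i.succ - C (b i) * X j.succ : A 4 K)) '' ((S' ∩ S : Finset (Fin 4)) : Set (Fin 4))))))).subschemeι ≠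
      ⊥ := by
  classical
  set J := Ideal.span (insert (X 0 - rename Fin.succ H)
        (((fun k : Fin 4 => (X k.succ - C (b k) : A 4 K)) '' ((S' \ S : Finset (Fin 4)) : Set (Fin 4))) ∪
         ((fun i : Fin 4 => (X i.succ - C (b i) * X j.succ : A 4 K)) '' ((S' ∩ S : Finset (Fin 4)) : Set (Fin 4))))) with hJ
  haveI hprime : J.IsPrime := by rw [hJ]; exact isPrime_graph hjS' b H
  -- `x_j ∉ J_Y`: under `Ξ₁Ξ₂` this is `x_j ∉ (z, x_{S'})`
  have hxj : (X j.succ : A 4 K) ∉ J := by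
    obtain ⟨Ξ₂, h20, h2s⟩ := exists_algEquiv_shear (S := S) hjS' b
    obtain ⟨Ξ₁, h10, h1s⟩ := exists_algEquiv_clean (K := K) (-H)
    rw [map_neg, ← sub_eq_add_neg] at h10
    rw [hJ, ← map_map_IΛ_eq_graph h20 h2s h10 h1s, Ideal.map_map]
    have hc : (Ξ₁ : A 4 K →+* A 4 K).comp (Ξ₂ : A 4 K →+* A 4 K) =
        ((Ξ₂.trans Ξ₁).toRingEquiv : A 4 K →+* A 4 K) := RingHom.ext fun x => rfl
    rw [hc, Ideal.map_comap_of_equiv, Ideal.mem_comap]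
    have hfix : (Ξ₂.trans Ξ₁).toRingEquiv.symm (X j.succ) = X j.succ := by
      rw [RingEquiv.symm_apply_eq]
      change X j.succ = Ξ₁ (Ξ₂ (X j.succ))
      rw [h2s j, if_neg hjS', h1s]
    rw [hfix]
    exact X_succ_not_mem_IΛ hjS'
  -- the generic point of `Y`
  let η : P 4 K := ⟨J, hprime⟩
  have hηY : η ∈ (Hironaka2005.idealSheafOf J).support := (mem_support_idealSheafOf_iff J η).mpr le_rfl
  have hηC : η ∉ (AffineCoordBlowup.𝓘Λ 4 K (insert 0 (Fin.succ '' (S : Set (Fin 4))))).support := by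
    rw [AffineCoordBlowup.support_𝓘Λ, AffineCoordBlowup.mem_CΛ_iff']
    intro h
    exact hxj (h j.succ (succ_mem_centreVars hj))
  intro hbot
  obtain ⟨y, hy⟩ : η ∈ Set.range (Hironaka2005.idealSheafOf J).subschemeι := by
    rw [Scheme.IdealSheafData.range_subschemeι]; exact hηY
  have : y ∈ ((AffineCoordBlowup.𝓘Λ 4 K (insert 0 (Fin.succ '' (S : Set (Fin 4))))).comap
      (Hironaka2005.idealSheafOf J).subschemeι).support := by
    rw [hbot, Scheme.IdealSheafData.support_bot]; trivial
  rw [Scheme.IdealSheafData.support_comap] at this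
  exact hηC (hy ▸ this)

end ChartDictionary

end Summit.ResolutionOfSingularities.ResolutionOfSingularities.Theorems.PIDim4

end
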